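import Summits.QuantumFields.YangMills.Theorems.BalabanStepParabolic.Negative.NoContinuityJunk
import HarnessLib

/-!
# `BalabanStepParabolic` — negative-side support: over-tuned thin inhabitant I (parabolic counting for the junk
# flow, depth shells, and the definitions of the continuous germ)

Part 1 of 4 of the over-tuned thin inhabitant (crux `stmt-QuantumFields-9684`, drefute gen 2; statement and
discussion in `OverTunedInhabitant.lean` and `Cruxes/BalabanStepParabolic/DREFUTE2-stub_regulatorChartOdd.md`).
* §2 `inv_sq_φJ_le`, `growth_iterate_φJ`, `inv_sq_φJ_le_sub`, **`counting_φJ`**: for the junk flow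
  `φ g = g + (log M) g³`, an orbit of a positive coupling `γ` that has not passed `T` after `k` steps satisfies
  `b k ≤ 1/γ² + b N_T` (`3bT² < (16/9)^{N_T}`): it is OVER-TUNED for its depth.
* §3 `kIdx` (least `k` with `(1/2)^k < 4s/3`; `kIdx ((1/2)^k) = k` exactly, no logarithms), the shell weight
  `shellW` (tent of relative half-width `1/8` around each shell, `1` on the shell), its vanishing on the dyadic
  gaps and beyond `9/8`, its explicit form on the dyadic windows, and the dyadic band cover `exists_band`.
* §4a definitions: `clampU`, `tentZ`, decoded coupling `γOf`, transported data `dataW` / `Efn`, the germ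
  `germC` = shell weight × orbit localiser × transported data (`0` on mixed strings / even or zero base tori,
  `1` for `n = 0`), the functional `expectC = orbitRec … germC`, and the branches `germMain`, `germWin`.
-/

namespace Summit.QuantumFields.YangMills.Theorems.BalabanStepParabolic.Negative

open scoped SchwartzMap
open MeasureTheory Filter Topology
open Literature.MathematicalPhysics.QuantumFieldTheory Literature.MathematicalPhysics.AQFT
open Literature.MathematicalPhysics.QuantumLattice

noncomputable section

/-! ### §2 Parabolic counting for the junk flow `φJ M g = g + (log M) g³` -/

section Counting

variable (M : ℕ)

/-- One junk step in inverse-square coordinates: `1/φ(g)² ≤ 1/g² − 2b + 3b²g²` (`b = log M ≥ 0`, `g > 0`). [folklore] -/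
theorem inv_sq_φJ_le {g : ℝ} (hg : 0 < g) (hb : 0 ≤ Real.log M) :
    1 / (φJ M g) ^ 2 ≤ 1 / g ^ 2 - 2 * Real.log M + 3 * (Real.log M) ^ 2 * g ^ 2 := by
  set b := Real.log M with hbdef
  have hu : 0 ≤ b * g ^ 2 := by positivity
  have hφ : φJ M g = g * (1 + b * g ^ 2) := by simp only [φJ, ← hbdef]; ring
  have hpos : 0 < 1 + b * g ^ 2 := by positivity
  rw [hφ, mul_pow]
  have hg2 : 0 < g ^ 2 := by positivity
  have hq : 0 < (1 + b * g ^ 2) ^ 2 := by positivity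
  rw [div_le_iff₀ (by positivity)]
  -- (1/g² − 2b + 3b²g²)·g²(1+bg²)² ≥ 1  ⟸  (1 − 2u + 3u²)(1+u)² ≥ 1 with u = b g²
  have key : 1 ≤ (1 - 2 * (b * g ^ 2) + 3 * (b * g ^ 2) ^ 2) * (1 + b * g ^ 2) ^ 2 := by
    nlinarith [pow_nonneg hu 3, pow_nonneg hu 4, sq_nonneg (b * g ^ 2)]
  have e : (1 / g ^ 2 - 2 * b + 3 * b ^ 2 * g ^ 2) * (g ^ 2 * (1 + b * g ^ 2) ^ 2) =
      (1 - 2 * (b * g ^ 2) + 3 * (b * g ^ 2) ^ 2) * (1 + b * g ^ 2) ^ 2 := by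
    field_simp
  rw [e]
  exact key

/-- The junk flow is positive on positive couplings (`log M ≥ 0`). [folklore] -/
theorem φJ_pos {g : ℝ} (hg : 0 < g) (hb : 0 ≤ Real.log M) : 0 < φJ M g := by
  unfold φJ; nlinarith [pow_pos hg 3, mul_nonneg hb (pow_pos hg 3).le]

/-- The junk flow does not decrease non-negative couplings. [folklore] -/
theorem le_φJ {g : ℝ} (hg : 0 ≤ g) (hb : 0 ≤ Real.log M) : g ≤ φJ M g := by
  unfold φJ; nlinarith [pow_nonneg hg 3]

/-- Iterates of the junk flow stay above the starting coupling and non-negative. [folklore] -/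
theorem le_iterate_φJ (hb : 0 ≤ Real.log M) {γ : ℝ} (hγ : 0 ≤ γ) (j : ℕ) :
    γ ≤ (φJ M)^[j] γ := by
  induction j with
  | zero => simp
  | succ j ih =>
    rw [Function.iterate_succ_apply']
    exact ih.trans (le_φJ M (hγ.trans ih) hb)

/-- Iterates of the junk flow are monotone in the number of steps. [folklore] -/
theorem iterate_φJ_mono (hb : 0 ≤ Real.log M) {γ : ℝ} (hγ : 0 ≤ γ) {j j' : ℕ} (hjj : j ≤ j') :
    (φJ M)^[j] γ ≤ (φJ M)^[j'] γ := by
  obtain ⟨d, rfl⟩ := Nat.exists_eq_add_of_le hjj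
  rw [add_comm, Function.iterate_add_apply]
  exact le_iterate_φJ M hb ((hγ.trans (le_iterate_φJ M hb hγ j))) d

/-- The junk flow is continuous. [folklore] -/
theorem continuous_φJ : Continuous (φJ M) := by unfold φJ; fun_prop

/-- **Fast phase**: above the threshold `γ² ≥ 1/(3b)` every junk step multiplies the coupling by at
least `4/3`, so `(4/3)^j γ ≤ φ^j(γ)`. [folklore] -/
theorem growth_iterate_φJ (hb : 0 < Real.log M) {γ : ℝ} (hγ0 : 0 < γ) (hγ : 1 / (3 * Real.log M) ≤ γ ^ 2)
    (j : ℕ) : (4 / 3 : ℝ) ^ j * γ ≤ (φJ M)^[j] γ := by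
  induction j with
  | zero => simp
  | succ j ih =>
    rw [Function.iterate_succ_apply', pow_succ]
    set y := (φJ M)^[j] γ with hy
    have hyγ : γ ≤ y := le_iterate_φJ M hb.le hγ0.le j
    have hy0 : 0 < y := hγ0.trans_le hyγ
    have hy2 : 1 / (3 * Real.log M) ≤ y ^ 2 := hγ.trans (pow_le_pow_left₀ hγ0.le hyγ 2)
    have hby : 1 / 3 ≤ Real.log M * y ^ 2 := by
      rw [div_le_iff₀ (by positivity)] at hy2
      linarith
    have hstep : 4 / 3 * y ≤ φJ M y := by
      unfold φJ
      nlinarith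
    calc (4 / 3 : ℝ) ^ j * (4 / 3) * γ = 4 / 3 * ((4 / 3 : ℝ) ^ j * γ) := by ring
      _ ≤ 4 / 3 * y := by gcongr
      _ ≤ φJ M y := hstep

/-- **Slow phase**: below the threshold one junk step lowers `1/g²` by at least `b`. [folklore] -/
theorem inv_sq_φJ_le_sub (hb : 0 < Real.log M) {g : ℝ} (hg : 0 < g) (hsmall : g ^ 2 ≤ 1 / (3 * Real.log M)) :
    1 / (φJ M g) ^ 2 ≤ 1 / g ^ 2 - Real.log M := by
  have h := inv_sq_φJ_le M hg hb.le
  have h3 : 3 * (Real.log M) ^ 2 * g ^ 2 ≤ Real.log M := by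
    rw [le_div_iff₀ (by positivity)] at hsmall
    nlinarith
  linarith

/-- **Parabolic counting.** If the depth-`k` junk orbit of a positive coupling `γ` has not passed `T`,
then `b k ≤ 1/γ² + b N` for any `N` with `3 b T² < (16/9)^N` (`b = log M > 0`): at most `N` steps are fast,
and every slow step costs `b` in `1/g²`. [folklore] -/
theorem counting_φJ (hb : 0 < Real.log M) {T : ℝ} {N : ℕ} (hN : 3 * Real.log M * T ^ 2 < (16 / 9 : ℝ) ^ N) :
    ∀ (k : ℕ) (γ : ℝ), 0 < γ → (φJ M)^[k] γ ≤ T → Real.log M * k ≤ 1 / γ ^ 2 + Real.log M * N := by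
  intro k
  induction k with
  | zero => intro γ hγ _; simp only [CharP.cast_eq_zero, mul_zero]; positivity
  | succ k ih =>
    intro γ hγ hT
    by_cases hsmall : γ ^ 2 ≤ 1 / (3 * Real.log M)
    · -- slow step first, then induction
      have hγ' : 0 < φJ M γ := φJ_pos M hγ hb.le
      rw [Function.iterate_succ_apply] at hT
      have h1 := ih (φJ M γ) hγ' hT
      have h2 := inv_sq_φJ_le_sub M hb hγ hsmall
      push_cast
      nlinarith
    · -- fast phase: all k+1 steps multiply by ≥ 4/3, so k+1 < N
      rw [not_le] at hsmall
      have hgrow := growth_iterate_φJ M hb hγ hsmall.le (k + 1)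
      have hle : (4 / 3 : ℝ) ^ (k + 1) * γ ≤ T := hgrow.trans hT
      have hT0 : 0 ≤ T := le_trans (by positivity) hle
      have hsq : ((4 / 3 : ℝ) ^ (k + 1) * γ) ^ 2 ≤ T ^ 2 := pow_le_pow_left₀ (by positivity) hle 2
      have hlt : (16 / 9 : ℝ) ^ (k + 1) < (16 / 9 : ℝ) ^ N := by
        have e : ((4 / 3 : ℝ) ^ (k + 1) * γ) ^ 2 = (16 / 9 : ℝ) ^ (k + 1) * γ ^ 2 := by
          rw [mul_pow, ← pow_mul, mul_comm (k + 1) 2, pow_mul]; norm_num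
        rw [e] at hsq
        have h3 : 1 < 3 * Real.log M * γ ^ 2 := by
          rw [div_lt_iff₀ (by positivity)] at hsmall; linarith
        have h169 : 0 < (16 / 9 : ℝ) ^ (k + 1) := by positivity
        nlinarith
      have hkN : k + 1 < N := (pow_lt_pow_iff_right₀ (by norm_num : (1 : ℝ) < 16 / 9)).1 hlt
      have : Real.log M * (k + 1 : ℕ) ≤ Real.log M * N := by
        gcongr
      have hpos : 0 < 1 / γ ^ 2 := by positivity
      push_cast at this ⊢
      linarith

end Counting

/-! ### §3 Depth shells in the fibre coordinate -/

section Shells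

/-- For `s > 0` some power `(1/2)^k` lies below `4s/3`. [folklore] -/
theorem exists_half_pow_lt {s : ℝ} (hs : 0 < s) : ∃ k : ℕ, (1 / 2 : ℝ) ^ k < 4 * s / 3 :=
  exists_pow_lt_of_lt_one (by positivity) (by norm_num)

open Classical in
/-- **Shell index** `kIdx s`: the least `k` with `(1/2)^k < 4s/3` (so `kIdx ((1/2)^k) = k` EXACTLY, no
logarithms); junk value `0` for `s ≤ 0`. -/
def kIdx (s : ℝ) : ℕ := if hs : 0 < s then Nat.find (exists_half_pow_lt hs) else 0

open Classical in
/-- Defining property of the shell index. [folklore] -/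
theorem kIdx_spec {s : ℝ} (hs : 0 < s) : (1 / 2 : ℝ) ^ kIdx s < 4 * s / 3 := by
  unfold kIdx; rw [dif_pos hs]; exact Nat.find_spec (exists_half_pow_lt hs)

open Classical in
/-- Minimality of the shell index. [folklore] -/
theorem kIdx_le_of {s : ℝ} (hs : 0 < s) {k : ℕ} (h : (1 / 2 : ℝ) ^ k < 4 * s / 3) : kIdx s ≤ k := by
  unfold kIdx; rw [dif_pos hs]; exact Nat.find_min' _ h

/-- Lower bound for the shell index. [folklore] -/
theorem le_kIdx_of {s : ℝ} (hs : 0 < s) {k : ℕ} (h : ∀ m < k, 4 * s / 3 ≤ (1 / 2 : ℝ) ^ m) : k ≤ kIdx s := by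
  by_contra hlt
  rw [not_le] at hlt
  exact (not_lt.2 (h _ hlt)) (kIdx_spec hs)

/-- Powers of `1/2` below an index are at least twice the power at the index. [folklore] -/
theorem two_mul_half_pow_le {m k : ℕ} (hmk : m < k) : 2 * (1 / 2 : ℝ) ^ k ≤ (1 / 2 : ℝ) ^ m := by
  have h : (1 / 2 : ℝ) ^ k ≤ (1 / 2 : ℝ) ^ (m + 1) :=
    pow_le_pow_of_le_one (by norm_num) (by norm_num) hmk
  rw [pow_succ] at h
  linarith

/-- The shell index is `k` on the window `(13/16, 5/4)·(1/2)^k` (which contains the shell `(1/2)^k`). [folklore] -/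
theorem kIdx_eq_of_window {s : ℝ} {k : ℕ} (h1 : 13 / 16 * (1 / 2 : ℝ) ^ k < s) (h2 : s < 5 / 4 * (1 / 2 : ℝ) ^ k) :
    kIdx s = k := by
  have hpk : 0 < (1 / 2 : ℝ) ^ k := by positivity
  have hs : 0 < s := lt_trans (by positivity) h1
  refine le_antisymm (kIdx_le_of hs (by linarith)) (le_kIdx_of hs fun m hm => ?_)
  have := two_mul_half_pow_le hm
  linarith

/-- The shell itself: `kIdx ((1/2)^k) = k`. [folklore] -/
theorem kIdx_half_pow (k : ℕ) : kIdx ((1 / 2 : ℝ) ^ k) = k := by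
  have hpk : 0 < (1 / 2 : ℝ) ^ k := by positivity
  exact kIdx_eq_of_window (by linarith) (by linarith)

/-- On the gap `(9/16, 7/8)·(1/2)^k` the shell index is `k` or `k+1`. [folklore] -/
theorem kIdx_mem_of_gap {s : ℝ} {k : ℕ} (h1 : 9 / 16 * (1 / 2 : ℝ) ^ k < s) (h2 : s < 7 / 8 * (1 / 2 : ℝ) ^ k) :
    kIdx s = k ∨ kIdx s = k + 1 := by
  have hpk : 0 < (1 / 2 : ℝ) ^ k := by positivity
  have hs : 0 < s := lt_trans (by positivity) h1
  have hup : kIdx s ≤ k + 1 := kIdx_le_of hs (by rw [pow_succ]; linarith)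
  have hlow : k ≤ kIdx s := le_kIdx_of hs fun m hm => by have := two_mul_half_pow_le hm; linarith
  omega

/-- Small `s` forces deep shells: `s < (3/4)(1/2)^k₀ ⇒ k₀ < kIdx s`. [folklore] -/
theorem lt_kIdx_of_small {s : ℝ} (hs : 0 < s) {k₀ : ℕ} (h : s < 3 / 4 * (1 / 2 : ℝ) ^ k₀) : k₀ < kIdx s := by
  have := le_kIdx_of hs (k := k₀ + 1) fun m hm => by
    have hm' : m ≤ k₀ := Nat.lt_succ_iff.1 hm
    have hpow : (1 / 2 : ℝ) ^ k₀ ≤ (1 / 2 : ℝ) ^ m := pow_le_pow_of_le_one (by norm_num) (by norm_num) hm'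
    linarith
  omega

/-- **Shell weight** `Λ(s) = max 0 (1 − 8·|2^{kIdx s} s − 1|)` for `s > 0` (a tent of relative half-width
`1/8` around each shell `(1/2)^k`, `= 1` exactly on the shell), `0` for `s ≤ 0`. -/
def shellW (s : ℝ) : ℝ := if 0 < s then max 0 (1 - 8 * |2 ^ kIdx s * s - 1|) else 0

/-- `0 ≤ Λ ≤ 1`. [folklore] -/
theorem shellW_mem (s : ℝ) : 0 ≤ shellW s ∧ shellW s ≤ 1 := by
  unfold shellW
  split_ifs
  · exact ⟨le_max_left _ _, max_le zero_le_one (by linarith [abs_nonneg (2 ^ kIdx s * s - 1)])⟩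
  · exact ⟨le_rfl, zero_le_one⟩

/-- `Λ = 1` exactly on the shells. [folklore] -/
theorem shellW_half_pow (k : ℕ) : shellW ((1 / 2 : ℝ) ^ k) = 1 := by
  have hpk : 0 < (1 / 2 : ℝ) ^ k := by positivity
  unfold shellW
  rw [if_pos hpk, kIdx_half_pow, ← mul_pow]
  norm_num

/-- `Λ` vanishes where the relative distance to the indexed shell is at least `1/8`. [folklore] -/
theorem shellW_eq_zero_of {s : ℝ} (h : 1 / 8 ≤ |2 ^ kIdx s * s - 1|) : shellW s = 0 := by
  unfold shellW
  split_ifs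
  · exact max_eq_left (by linarith)
  · rfl

/-- `Λ` vanishes on the gaps `(9/16, 7/8)·(1/2)^k`. [folklore] -/
theorem shellW_eq_zero_of_gap {s : ℝ} {k : ℕ} (h1 : 9 / 16 * (1 / 2 : ℝ) ^ k < s) (h2 : s < 7 / 8 * (1 / 2 : ℝ) ^ k) :
    shellW s = 0 := by
  have hpk : 0 < (1 / 2 : ℝ) ^ k := by positivity
  have h2k : (2 : ℝ) ^ k * (1 / 2 : ℝ) ^ k = 1 := by rw [← mul_pow]; norm_num
  refine shellW_eq_zero_of ?_
  rcases kIdx_mem_of_gap h1 h2 with h | h <;> rw [h]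
  · -- 2^k s < 7/8
    have : (2 : ℝ) ^ k * s < 7 / 8 := by
      have := mul_lt_mul_of_pos_left h2 (show (0 : ℝ) < 2 ^ k by positivity)
      have e : (2 : ℝ) ^ k * (7 / 8 * (1 / 2) ^ k) = 7 / 8 := by linear_combination (7 / 8 : ℝ) * h2k
      linarith
    rw [abs_of_neg (by linarith)]; linarith
  · -- 2^(k+1) s > 9/8
    have : 9 / 8 < (2 : ℝ) ^ (k + 1) * s := by
      have := mul_lt_mul_of_pos_left h1 (show (0 : ℝ) < 2 ^ (k + 1) by positivity)
      have e : (2 : ℝ) ^ (k + 1) * (9 / 16 * (1 / 2) ^ k) = 9 / 8 := by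
        rw [pow_succ]; linear_combination (9 / 8 : ℝ) * h2k
      linarith
    rw [abs_of_pos (by linarith)]; linarith

/-- `Λ` vanishes beyond `9/8`. [folklore] -/
theorem shellW_eq_zero_of_large {s : ℝ} (h : 9 / 8 < s) : shellW s = 0 := by
  have hs : 0 < s := by linarith
  have hk : kIdx s = 0 := le_antisymm (kIdx_le_of hs (by simp; linarith)) (Nat.zero_le _)
  refine shellW_eq_zero_of ?_
  rw [hk, pow_zero, one_mul, abs_of_pos (by linarith)]; linarith

/-- On the window `(13/16, 5/4)·(1/2)^k` the weight is the explicit `k`-th tent. [folklore] -/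
theorem shellW_eq_of_window {s : ℝ} {k : ℕ} (h1 : 13 / 16 * (1 / 2 : ℝ) ^ k < s) (h2 : s < 5 / 4 * (1 / 2 : ℝ) ^ k) :
    shellW s = max 0 (1 - 8 * |2 ^ k * s - 1|) := by
  have hs : 0 < s := lt_trans (by positivity) h1
  unfold shellW; rw [if_pos hs, kIdx_eq_of_window h1 h2]

/-- Every `s ∈ (0, 5/4)` lies in some dyadic band `(9/16, 5/4)·(1/2)^k` (window ∪ gap). [folklore] -/
theorem exists_band {s : ℝ} (hs : 0 < s) (hs' : s < 5 / 4) :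
    ∃ k : ℕ, 9 / 16 * (1 / 2 : ℝ) ^ k < s ∧ s < 5 / 4 * (1 / 2 : ℝ) ^ k := by
  classical
  have hex : ∃ k : ℕ, (1 / 2 : ℝ) ^ k < 16 * s / 9 := exists_pow_lt_of_lt_one (by positivity) (by norm_num)
  refine ⟨Nat.find hex, ?_, ?_⟩
  · have := Nat.find_spec hex; linarith
  · rcases Nat.eq_zero_or_pos (Nat.find hex) with h0 | hpos
    · rw [h0, pow_zero]; linarith
    · have hmin := Nat.find_min hex (Nat.sub_one_lt_of_lt hpos)
      rw [not_lt] at hmin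
      have e : (1 / 2 : ℝ) ^ (Nat.find hex - 1) = 2 * (1 / 2 : ℝ) ^ Nat.find hex := by
        conv_rhs => rw [show Nat.find hex = Nat.find hex - 1 + 1 by omega, pow_succ]
        ring
      rw [e] at hmin
      linarith

end Shells

/-! ### §4a Definitions of the germ and of the realisation functional (theorems in part II) -/

section GermDefs

variable {G : Type} [Group G] [TopologicalSpace G] [IsTopologicalGroup G] [CompactSpace G]
  [MeasurableSpace G] [BorelSpace G] (r : LatticeRep G) (M : ℕ) (κ : ℝ)

/-- Clamp to `[0, 1]`. -/
def clampU (t : ℝ) : ℝ := max 0 (min t 1)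

/-- Tent at `0` of half-width `1`. -/
def tentZ (u : ℝ) : ℝ := max 0 (1 - |u|)

/-- **Decoded coupling** of a thin-chart point `(x, (s, w))`: `clamp(w/s)` — on the junk Wilson orbit
`(φ^k g, 2^{-k}, 2^{-k} g)` this is exactly `g`. -/
def γOf (q : ℝ × (ℝ × ℝ)) : ℝ := clampU (q.2.2 / q.2.1)

/-- **Transported pure-curvature Wilson data** at depth `k` on the base torus `S₀`: the genuine centred
curvature `n`-point function at inverse coupling `β` on the torus `M^k S₀` with `k`-fold dilated test
functions. -/
def dataW (S₀ n : ℕ) (h : Fin n → 𝓢(EuclideanSpace ℝ (Fin 4), ℝ)) (k : ℕ) (β : ℝ) : ℝ :=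
  wilsonCentredSchwinger r.ρ β ((M ^ k * S₀ - 1) / 2) (fun _ => 1) n (fun _ => r.curvature)
    (fun i => (blockDilate M)^[k] (h i))

/-- The data read through the dictionary `β = κ/γ²` of the decoded coupling (`0` for `γ ≤ 0`). -/
def Efn (S₀ n : ℕ) (h : Fin n → 𝓢(EuclideanSpace ℝ (Fin 4), ℝ)) (k : ℕ) (γ : ℝ) : ℝ :=
  if 0 < γ then dataW r M S₀ n h k (κ / γ ^ 2) else 0

open Classical in
/-- **The continuous germ** of the over-tuned thin inhabitant on base tori `S₀`: zero on mixed species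
strings and on even/zero base tori, `1` for the `0`-point function, and otherwise
`Λ(s) · ζ(x − φ^{k(s)}(γ)) · E_{k(s)}(γ)` — shell weight × orbit localiser × transported data. -/
def germC (n : ℕ) (σ : Fin n → YMSpecies G) (q : ℝ × (ℝ × ℝ)) (S₀ : ℕ)
    (h : Fin n → 𝓢(EuclideanSpace ℝ (Fin 4), ℝ)) : ℝ :=
  if (∀ i, σ i = r.curvature) then
    if Odd S₀ then
      if n = 0 then 1
      else shellW q.2.1 * tentZ (q.1 - (φJ M)^[kIdx q.2.1] (γOf q)) * Efn r M κ S₀ n h (kIdx q.2.1) (γOf q)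
    else 0
  else 0

variable (hM : 2 ≤ M)

/-- The realisation functional of the over-tuned thin inhabitant (orbit recursion over the germ). -/
def expectC (n : ℕ) (σ : Fin n → YMSpecies G) (p : ℝ × (ℝ × ℝ)) (S : ℕ)
    (f : Fin n → 𝓢(EuclideanSpace ℝ (Fin 4), ℝ)) : ℝ :=
  orbitRec M (FJ M) (contractTuple M) (germC r M κ n σ) hM p S f

/-- The main branch of the germ. -/
def germMain (S₀ n : ℕ) (h : Fin n → 𝓢(EuclideanSpace ℝ (Fin 4), ℝ)) (q : ℝ × (ℝ × ℝ)) : ℝ :=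
  shellW q.2.1 * tentZ (q.1 - (φJ M)^[kIdx q.2.1] (γOf q)) * Efn r M κ S₀ n h (kIdx q.2.1) (γOf q)

/-- The main branch on the window of shell `k`: the explicit `k`-th expression. -/
def germWin (S₀ n : ℕ) (h : Fin n → 𝓢(EuclideanSpace ℝ (Fin 4), ℝ)) (k : ℕ) (q : ℝ × (ℝ × ℝ)) : ℝ :=
  max 0 (1 - 8 * |2 ^ k * q.2.1 - 1|) * tentZ (q.1 - (φJ M)^[k] (γOf q)) * Efn r M κ S₀ n h k (γOf q)

end GermDefs

end

end Summit.QuantumFields.YangMills.Theorems.BalabanStepParabolic.Negative
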